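import Mathlib.Analysis.SpecialFunctions.Log.Deriv
import Mathlib.Analysis.SpecialFunctions.ExpDeriv
import Mathlib.Analysis.Calculus.Deriv.MeanValue
import Mathlib.Algebra.Order.BigOperators.Ring.Finset
import Mathlib.Algebra.BigOperators.Field
import HarnessLib

/-!
# Binary relative entropy: the Dewan–Muirhead generalised Pinsker inequality and
# Hutchcroft's Bernoulli estimate (Lemma 4.3)

Topic `Literature/Probability/Entropy`. Elementary relative-entropy inequalities entering the
relative-entropy method of Dewan–Muirhead as used by Hutchcroft (J. Stat. Phys. 189 (2022),
§4) to derive `β = 1`, `δ = 2` from `γ = 1` in percolation (the target being a discharge of the named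
fact `Literature.Probability.Percolation.Hutchcroft2022_thm13`, `MeanFieldBetaFromGamma.lean`).
All statements are proved.

* `binaryKL a b = a log(a/b) + (1-a) log((1-a)/(1-b))` — the relative entropy
  `D_KL(Ber(a) ‖ Ber(b))` for `a, b ∈ (0,1)` (junk values of `Real.log` outside);
  `hasDerivAt_binaryKL` (`∂_b kl(a‖b) = -a/b + (1-a)/(1-b)`);
* `sq_sub_le_two_mul_binaryKL_mul_max` — **the binary Dewan–Muirhead inequality**
  `(a - b)² ≤ 2 kl(a‖b) max{a,b}` for `a, b ∈ (0,1)` (monotonicity of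
  `t ↦ kl(a‖t) - (t-a)²/(2t)` on `[a,b]`, resp. of `kl(a‖t) - (a-t)²/(2a)` on `[b,a]`);
* `binaryKL_one_sub_exp_le` — **Hutchcroft 2022, Lemma 4.3**:
  `kl(1 - e^{-a} ‖ 1 - e^{-b}) ≤ (a-b)²/(2 min{a,b})` for `a, b > 0`, along the printed proof recast
  as derivative estimates (`(e^{-a} - e^{-t})/(1-e^{-t}) ≤ (t-a)/a` for `t ≥ a`, using `1 + t ≤ e^t`);
* `sum_mul_log_div_le` — the **log-sum inequality** on a finite set (`log x ≥ 1 - 1/x`), and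
  `binaryKL_le_sum_mul_log_div` — `kl(P(A) ‖ Q(A)) ≤ Σ_s P log(P/Q)` for probability weights
  `P ≥ 0`, `Q > 0` on `s ⊇ A` (data processing for the indicator of `A`);
* `sq_sub_le_two_mul_kl_mul_max` — **the generalised Pinsker inequality of Dewan–Muirhead**,
  `|P(A) - Q(A)|² ≤ 2 D_KL(P‖Q) max{P(A), Q(A)}`, for finitely supported laws with full support
  (`P, Q > 0` on `s`, the form in which it is applied to exploration transcripts).

Mathlib has the general `InformationTheory.klDiv` (measure-theoretic, `ℝ≥0∞`-valued, with Gibbs'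
inequality); the finite-sum forms above are what the percolation application consumes and are
proved directly. `Literature.Probability.Entropy.FiniteShannon` treats Shannon entropy of finite
weighted families (no relative entropy).

## References

* T. Hutchcroft, *On the derivation of mean-field percolation critical exponents from the triangle
  condition*, J. Stat. Phys. 189 (2022) no. 6 (arXiv:2106.06400), §4: the generalised Pinsker
  display, Lemma 4.3 and its proof, proof of Thm. 4.1.
* V. Dewan, S. Muirhead, *Upper bounds on the one-arm exponent for dependent percolation models*,
  Probab. Theory Relat. Fields (2022) (the original generalised Pinsker inequality, as cited by
  Hutchcroft).
-/

noncomputable section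

namespace Literature.Probability.Entropy

open Real Finset

/-! ### The binary relative entropy -/

/-- The **binary relative entropy** (Kullback–Leibler divergence between Bernoulli laws)
`kl(a ‖ b) = a log(a/b) + (1-a) log((1-a)/(1-b))`, for `a, b ∈ (0, 1)` (junk values of `Real.log`
outside). [cite: Hutchcroft2022Triangle, §4 (proof of Lemma 4.3: D_KL(Ber(p) ‖ Ber(q)) = p log(p/q) + (1-p) log((1-p)/(1-q)))] -/
def binaryKL (a b : ℝ) : ℝ := a * log (a / b) + (1 - a) * log ((1 - a) / (1 - b))

/-- Unfolding lemma. [folklore] -/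
theorem binaryKL_def (a b : ℝ) :
    binaryKL a b = a * log (a / b) + (1 - a) * log ((1 - a) / (1 - b)) := rfl

/-- `kl(a ‖ a) = 0`. [folklore] -/
@[simp] theorem binaryKL_self (a : ℝ) : binaryKL a a = 0 := by
  unfold binaryKL
  by_cases h0 : a = 0
  · subst h0; simp
  by_cases h1 : a = 1
  · subst h1; simp
  have h1' : (1 : ℝ) - a ≠ 0 := sub_ne_zero.2 (Ne.symm h1)
  rw [div_self h0, div_self h1', log_one, mul_zero, mul_zero, add_zero]

/-- Expanded form for `a ∈ [0,1]`, `b ∈ (0,1)`: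
`kl(a ‖ b) = a log a + (1-a) log(1-a) - a log b - (1-a) log(1-b)`. [folklore] -/
theorem binaryKL_eq (a : ℝ) {b : ℝ} (hb : 0 < b) (hb1 : b < 1) :
    binaryKL a b = a * log a + (1 - a) * log (1 - a) - a * log b - (1 - a) * log (1 - b) := by
  unfold binaryKL
  by_cases h0 : a = 0
  · subst h0; simp
  by_cases h1 : a = 1
  · subst h1; simp
  rw [log_div h0 hb.ne', log_div (sub_ne_zero.2 (Ne.symm h1)) (by linarith)]
  ring

/-- The derivative of `b ↦ kl(a ‖ b)` on `(0, 1)` is `(b - a)/(b(1 - b)) = -a/b + (1-a)/(1-b)`.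
[cite: Hutchcroft2022Triangle, proof of Lemma 4.3 (kl(p ‖ q) = ∫_q^p (p - s)/(s(1-s)) ds)] -/
theorem hasDerivAt_binaryKL (a : ℝ) {b : ℝ} (hb : 0 < b) (hb1 : b < 1) :
    HasDerivAt (fun t => binaryKL a t) (-a / b + (1 - a) / (1 - b)) b := by
  have h1b : (1 : ℝ) - b ≠ 0 := by linarith
  have hlog1 : HasDerivAt (fun t : ℝ => log t) b⁻¹ b := hasDerivAt_log hb.ne'
  have hlog2 : HasDerivAt (fun t : ℝ => log (1 - t)) ((-1) / (1 - b)) b :=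
    ((hasDerivAt_id b).const_sub 1).log h1b
  have key : HasDerivAt (fun t => a * log a + (1 - a) * log (1 - a) - a * log t - (1 - a) * log (1 - t))
      (0 - a * b⁻¹ - (1 - a) * ((-1) / (1 - b))) b := by
    exact ((hasDerivAt_const b _).sub (hlog1.const_mul a)).sub (hlog2.const_mul (1 - a))
  have heq : ∀ᶠ t in nhds b, binaryKL a t =
      a * log a + (1 - a) * log (1 - a) - a * log t - (1 - a) * log (1 - t) := by
    have hIoo : Set.Ioo (0 : ℝ) 1 ∈ nhds b := Ioo_mem_nhds hb hb1
    filter_upwards [hIoo] with t ht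
    exact binaryKL_eq a ht.1 ht.2
  refine (key.congr_of_eventuallyEq heq).congr_deriv ?_
  field_simp
  ring

/-- `b ↦ kl(a ‖ b)` is continuous on `(0, 1)`. [folklore] -/
theorem continuousOn_binaryKL (a : ℝ) : ContinuousOn (fun t => binaryKL a t) (Set.Ioo 0 1) :=
  fun _ hb => (hasDerivAt_binaryKL a hb.1 hb.2).continuousAt.continuousWithinAt

/-- **Binary Pinsker-type inequality of Dewan–Muirhead**: for `a, b ∈ (0,1)`,
`(a - b)² ≤ 2 kl(a ‖ b) max{a, b}`. Proof: for `b ≥ a`, `t ↦ kl(a ‖ t) - (t-a)²/(2t)` vanishes at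
`t = a` and has derivative `(t-a)[1/(t(1-t)) - (t+a)/(2t²)] ≥ 0`; for `b ≤ a` symmetrically with
`(a-t)²/(2a)`. [cite: Hutchcroft2022Triangle, §4 (eq. (4.2), "generalization of Pinsker's inequality established in [Dewan–Muirhead]")] -/
theorem sq_sub_le_two_mul_binaryKL_mul_max {a b : ℝ} (ha : 0 < a) (ha1 : a < 1) (hb : 0 < b)
    (hb1 : b < 1) : (a - b) ^ 2 ≤ 2 * binaryKL a b * max a b := by
  rcases lt_trichotomy a b with hab | rfl | hba
  · -- `a < b`: `h(t) = kl(a‖t) - (t-a)²/(2t)` is monotone on `[a, b]`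
    rw [max_eq_right hab.le]
    set h : ℝ → ℝ := fun t => binaryKL a t - (t - a) ^ 2 / (2 * t) with hh
    have hderiv : ∀ t ∈ Set.Ioo a b, HasDerivAt h
        ((-a / t + (1 - a) / (1 - t)) - ((t - a) * (t + a)) / (2 * t ^ 2)) t := by
      intro t ht
      have ht0 : 0 < t := ha.trans ht.1
      have ht1 : t < 1 := ht.2.trans hb1
      have h2 : HasDerivAt (fun t => (t - a) ^ 2 / (2 * t)) (((t - a) * (t + a)) / (2 * t ^ 2)) t := by
        have hnum : HasDerivAt (fun t => (t - a) ^ 2) (2 * (t - a)) t := by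
          have h1 := ((hasDerivAt_id t).sub_const a).mul ((hasDerivAt_id t).sub_const a)
          refine (h1.congr_of_eventuallyEq (Filter.Eventually.of_forall fun s => ?_)).congr_deriv ?_
          · simp [pow_two]
          · simp; ring
        have hden : HasDerivAt (fun t : ℝ => 2 * t) 2 t := by simpa using (hasDerivAt_id t).const_mul 2
        have h := hnum.div hden (by positivity)
        refine h.congr_deriv ?_
        field_simp
        ring
      exact (hasDerivAt_binaryKL a ht0 ht1).sub h2
    have hcont : ContinuousOn h (Set.Icc a b) := by
      have hsub : Set.Icc a b ⊆ Set.Ioo 0 1 := fun t ht => ⟨ha.trans_le ht.1, ht.2.trans_lt hb1⟩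
      refine ((continuousOn_binaryKL a).mono hsub).sub ?_
      refine ContinuousOn.div (by fun_prop) (by fun_prop) fun t ht => ?_
      have : 0 < t := ha.trans_le ht.1
      positivity
    have hmono : MonotoneOn h (Set.Icc a b) := by
      refine monotoneOn_of_deriv_nonneg (convex_Icc a b) hcont ?_ ?_
      · rw [interior_Icc]
        exact fun t ht => (hderiv t ht).differentiableAt.differentiableWithinAt
      · rw [interior_Icc]
        intro t ht
        rw [(hderiv t ht).deriv]
        have ht0 : 0 < t := ha.trans ht.1
        have ht1 : t < 1 := ht.2.trans hb1
        have hta : 0 ≤ t - a := by linarith [ht.1]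
        have h1t : (1 : ℝ) - t ≠ 0 := by linarith
        have e1 : -a / t + (1 - a) / (1 - t) = (t - a) / (t * (1 - t)) := by
          field_simp
          ring
        rw [e1]
        have h1 : (t + a) / (2 * t ^ 2) ≤ 1 / (t * (1 - t)) := by
          rw [div_le_div_iff₀ (by positivity) (by positivity)]
          nlinarith [ht.1, mul_pos ht0 ht0, mul_pos ht0 ha]
        calc (0 : ℝ) ≤ (t - a) * (1 / (t * (1 - t)) - (t + a) / (2 * t ^ 2)) :=
              mul_nonneg hta (by linarith)
          _ = (t - a) / (t * (1 - t)) - (t - a) * (t + a) / (2 * t ^ 2) := by ring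
    have h0 : h a = 0 := by simp [hh]
    have hab' := hmono (Set.left_mem_Icc.2 hab.le) (Set.right_mem_Icc.2 hab.le) hab.le
    rw [h0] at hab'
    have hpos : 0 ≤ binaryKL a b - (b - a) ^ 2 / (2 * b) := hab'
    have : (b - a) ^ 2 / (2 * b) ≤ binaryKL a b := by linarith
    rw [div_le_iff₀ (by positivity)] at this
    nlinarith [this]
  · simp
  · -- `b < a`: `h(t) = kl(a‖t) - (a-t)²/(2a)` is antitone on `[b, a]`
    rw [max_eq_left hba.le]
    set h : ℝ → ℝ := fun t => binaryKL a t - (a - t) ^ 2 / (2 * a) with hh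
    have hderiv : ∀ t ∈ Set.Ioo b a, HasDerivAt h
        ((-a / t + (1 - a) / (1 - t)) - (-(2 * (a - t)) / (2 * a))) t := by
      intro t ht
      have ht0 : 0 < t := hb.trans ht.1
      have ht1 : t < 1 := ht.2.trans ha1
      have h2 : HasDerivAt (fun t => (a - t) ^ 2 / (2 * a)) (-(2 * (a - t)) / (2 * a)) t := by
        have hnum : HasDerivAt (fun t => (a - t) ^ 2) (-(2 * (a - t))) t := by
          have h1 := ((hasDerivAt_id t).const_sub a).mul ((hasDerivAt_id t).const_sub a)
          refine (h1.congr_of_eventuallyEq (Filter.Eventually.of_forall fun s => ?_)).congr_deriv ?_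
          · simp [pow_two]
          · simp; ring
        exact hnum.div_const (2 * a)
      exact (hasDerivAt_binaryKL a ht0 ht1).sub h2
    have hcont : ContinuousOn h (Set.Icc b a) := by
      have hsub : Set.Icc b a ⊆ Set.Ioo 0 1 := fun t ht => ⟨hb.trans_le ht.1, ht.2.trans_lt ha1⟩
      exact ((continuousOn_binaryKL a).mono hsub).sub (by fun_prop)
    have hanti : AntitoneOn h (Set.Icc b a) := by
      refine antitoneOn_of_deriv_nonpos (convex_Icc b a) hcont ?_ ?_
      · rw [interior_Icc]
        exact fun t ht => (hderiv t ht).differentiableAt.differentiableWithinAt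
      · rw [interior_Icc]
        intro t ht
        rw [(hderiv t ht).deriv]
        have ht0 : 0 < t := hb.trans ht.1
        have ht1 : t < 1 := ht.2.trans ha1
        have hta : 0 ≤ a - t := by linarith [ht.2]
        have h1t : (1 : ℝ) - t ≠ 0 := by linarith
        have e1 : -a / t + (1 - a) / (1 - t) - -(2 * (a - t)) / (2 * a) =
            -((a - t) * (1 / (t * (1 - t)) - 1 / a)) := by
          field_simp
          ring
        rw [e1, neg_nonpos]
        refine mul_nonneg hta ?_
        rw [sub_nonneg, div_le_div_iff₀ ha (by positivity)]
        nlinarith [ht.2, mul_pos ht0 ht0]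
    have h0 : h a = 0 := by simp [hh]
    have hba' := hanti (Set.left_mem_Icc.2 hba.le) (Set.right_mem_Icc.2 hba.le) hba.le
    rw [h0] at hba'
    have hpos : 0 ≤ binaryKL a b - (a - b) ^ 2 / (2 * a) := hba'
    have : (a - b) ^ 2 / (2 * a) ≤ binaryKL a b := by linarith
    rw [div_le_iff₀ (by positivity)] at this
    nlinarith [this]


/-! ### Hutchcroft's Lemma 4.3: `kl(1 - e^{-a} ‖ 1 - e^{-b}) ≤ (a-b)²/(2 min{a,b})` -/

/-- The derivative of `t ↦ kl(p ‖ 1 - e^{-t})` at `t > 0` is `e^{-t} (-p/(1-e^{-t}) + (1-p)/e^{-t})`,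
i.e. `(1 - p) - p e^{-t}/(1 - e^{-t})`. [cite: Hutchcroft2022Triangle, proof of Lemma 4.3] -/
theorem hasDerivAt_binaryKL_one_sub_exp (p : ℝ) {t : ℝ} (ht : 0 < t) :
    HasDerivAt (fun s => binaryKL p (1 - exp (-s))) ((1 - p) - p * exp (-t) / (1 - exp (-t))) t := by
  have hq0 : 0 < 1 - exp (-t) := by
    have : exp (-t) < 1 := exp_lt_one_iff.2 (by linarith)
    linarith
  have hq1 : 1 - exp (-t) < 1 := by linarith [exp_pos (-t)]
  have hinner : HasDerivAt (fun s : ℝ => 1 - exp (-s)) (exp (-t)) t := by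
    have h := ((hasDerivAt_id t).neg.exp).const_sub 1
    simpa using h
  have h := (hasDerivAt_binaryKL p hq0 hq1).comp t hinner
  refine h.congr_deriv ?_
  have hne : (1 : ℝ) - (1 - exp (-t)) = exp (-t) := by ring
  rw [hne]
  field_simp
  ring

/-- `e^{-t}/(1 - e^{-t}) ≤ 1/t` for `t > 0` (i.e. `t ≤ e^t - 1`). [cite: Hutchcroft2022Triangle, proof of Lemma 4.3 ("e^{-t}/(1-e^{-t}) ≤ t" rescaled; from 1 + t ≤ e^t)] -/
theorem exp_neg_div_one_sub_exp_neg_le {t : ℝ} (ht : 0 < t) : exp (-t) / (1 - exp (-t)) ≤ 1 / t := by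
  have hq0 : 0 < 1 - exp (-t) := by
    have : exp (-t) < 1 := exp_lt_one_iff.2 (by linarith)
    linarith
  rw [div_le_div_iff₀ hq0 ht, one_mul]
  have h1 : t + 1 ≤ exp t := add_one_le_exp t
  have h2 : exp (-t) * exp t = 1 := by rw [← exp_add]; simp
  nlinarith [exp_pos (-t)]

/-- `1 - e^{-x} ≤ x` for all real `x`. [folklore] -/
theorem one_sub_exp_neg_le (x : ℝ) : 1 - exp (-x) ≤ x := by
  linarith [add_one_le_exp (-x)]

/-- **Hutchcroft 2022, Lemma 4.3**: for `a, b > 0`,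
`D_KL(Ber(1 - e^{-a}) ‖ Ber(1 - e^{-b})) ≤ |a - b|²/(2 min{a, b})`. Proof along the printed lines,
recast as monotonicity of `t ↦ (t-a)²/(2a) - kl(1-e^{-a} ‖ 1-e^{-t})` on `[a, b]` (case `a ≤ b`;
derivative `≥ (t-a)/a - e^{-a}(t-a)/(1-e^{-a}) ≥ 0`) and antitonicity of
`t ↦ (a-t)²/(2t) - kl(1-e^{-a} ‖ 1-e^{-t})` on `[b, a]` (case `b ≤ a`).
[cite: Hutchcroft2022Triangle, Lemma 4.3] -/
theorem binaryKL_one_sub_exp_le {a b : ℝ} (ha : 0 < a) (hb : 0 < b) :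
    binaryKL (1 - exp (-a)) (1 - exp (-b)) ≤ (a - b) ^ 2 / (2 * min a b) := by
  set p : ℝ := 1 - exp (-a) with hp
  set G : ℝ → ℝ := fun t => binaryKL p (1 - exp (-t)) with hG
  have hGa : G a = 0 := by simp [hG, hp]
  -- the derivative of `G` and its sign-controlled bounds
  have hGd : ∀ t : ℝ, 0 < t → HasDerivAt G ((1 - p) - p * exp (-t) / (1 - exp (-t))) t :=
    fun t ht => hasDerivAt_binaryKL_one_sub_exp p ht
  have hformula : ∀ t : ℝ, 0 < t →
      (1 - p) - p * exp (-t) / (1 - exp (-t)) = (exp (-a) - exp (-t)) / (1 - exp (-t)) := by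
    intro t ht
    have hq0 : (1 : ℝ) - exp (-t) ≠ 0 := by
      have : exp (-t) < 1 := exp_lt_one_iff.2 (by linarith)
      linarith
    rw [hp]
    field_simp
    ring
  rcases le_total a b with hab | hba
  · -- case `a ≤ b`
    rw [min_eq_left hab]
    set H : ℝ → ℝ := fun t => (t - a) ^ 2 / (2 * a) - G t with hH
    have hHd : ∀ t ∈ Set.Ioo a b, HasDerivAt H
        (2 * (t - a) / (2 * a) - ((1 - p) - p * exp (-t) / (1 - exp (-t)))) t := by
      intro t ht
      have h1 : HasDerivAt (fun t => (t - a) ^ 2 / (2 * a)) (2 * (t - a) / (2 * a)) t := by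
        have h0 := ((hasDerivAt_id t).sub_const a).mul ((hasDerivAt_id t).sub_const a)
        have h0' : HasDerivAt (fun t => (t - a) ^ 2) (2 * (t - a)) t := by
          refine (h0.congr_of_eventuallyEq (Filter.Eventually.of_forall fun s => ?_)).congr_deriv ?_
          · simp [pow_two]
          · simp; ring
        exact h0'.div_const (2 * a)
      exact h1.sub (hGd t (ha.trans ht.1))
    have hcont : ContinuousOn H (Set.Icc a b) := by
      refine ContinuousOn.sub (by fun_prop) fun t ht => ?_
      exact (hGd t (ha.trans_le ht.1)).continuousAt.continuousWithinAt
    have hmono : MonotoneOn H (Set.Icc a b) := by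
      refine monotoneOn_of_deriv_nonneg (convex_Icc a b) hcont ?_ ?_
      · rw [interior_Icc]
        exact fun t ht => (hHd t ht).differentiableAt.differentiableWithinAt
      · rw [interior_Icc]
        intro t ht
        rw [(hHd t ht).deriv, hformula t (ha.trans ht.1)]
        have ht0 : 0 < t := ha.trans ht.1
        have hta : 0 ≤ t - a := by linarith [ht.1]
        have hqa : 0 < 1 - exp (-a) := by
          have : exp (-a) < 1 := exp_lt_one_iff.2 (by linarith); linarith
        have hqt : 1 - exp (-a) ≤ 1 - exp (-t) := by
          have := exp_le_exp.2 (neg_le_neg ht.1.le); linarith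
        -- `(e^{-a} - e^{-t})/(1 - e^{-t}) ≤ e^{-a}(t-a)/(1-e^{-a}) ≤ (t-a)/a`
        have hnum : exp (-a) - exp (-t) ≤ exp (-a) * (t - a) := by
          have h1 : exp (-a) - exp (-t) = exp (-a) * (1 - exp (-(t - a))) := by
            rw [mul_sub, mul_one, ← exp_add]; ring_nf
          rw [h1]
          exact mul_le_mul_of_nonneg_left (one_sub_exp_neg_le _) (exp_pos _).le
        have hstep : (exp (-a) - exp (-t)) / (1 - exp (-t)) ≤ (t - a) / a :=
          calc (exp (-a) - exp (-t)) / (1 - exp (-t)) ≤ exp (-a) * (t - a) / (1 - exp (-a)) := by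
                have hnum0 : 0 ≤ exp (-a) * (t - a) := mul_nonneg (exp_pos _).le hta
                calc (exp (-a) - exp (-t)) / (1 - exp (-t)) ≤ exp (-a) * (t - a) / (1 - exp (-t)) :=
                      div_le_div_of_nonneg_right hnum (hqa.le.trans hqt)
                  _ ≤ exp (-a) * (t - a) / (1 - exp (-a)) :=
                      div_le_div_of_nonneg_left hnum0 hqa hqt
            _ = exp (-a) / (1 - exp (-a)) * (t - a) := by ring
            _ ≤ 1 / a * (t - a) :=
                mul_le_mul_of_nonneg_right (exp_neg_div_one_sub_exp_neg_le ha) hta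
            _ = (t - a) / a := by ring
        have e2 : 2 * (t - a) / (2 * a) = (t - a) / a := by field_simp
        rw [e2]
        linarith
    have h := hmono (Set.left_mem_Icc.2 hab) (Set.right_mem_Icc.2 hab) hab
    have hHa : H a = 0 := by simp [hH, hGa]
    rw [hHa] at h
    have : 0 ≤ (b - a) ^ 2 / (2 * a) - G b := h
    have hsq : (b - a) ^ 2 = (a - b) ^ 2 := by ring
    rw [hsq] at this
    linarith
  · -- case `b ≤ a`
    rw [min_eq_right hba]
    set H : ℝ → ℝ := fun t => (a - t) ^ 2 / (2 * t) - G t with hH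
    have hHd : ∀ t ∈ Set.Ioo b a, HasDerivAt H
        (-((a - t) * (a + t)) / (2 * t ^ 2) - ((1 - p) - p * exp (-t) / (1 - exp (-t)))) t := by
      intro t ht
      have ht0 : 0 < t := hb.trans ht.1
      have h1 : HasDerivAt (fun t => (a - t) ^ 2 / (2 * t)) (-((a - t) * (a + t)) / (2 * t ^ 2)) t := by
        have h0 := ((hasDerivAt_id t).const_sub a).mul ((hasDerivAt_id t).const_sub a)
        have hnum : HasDerivAt (fun t => (a - t) ^ 2) (-(2 * (a - t))) t := by
          refine (h0.congr_of_eventuallyEq (Filter.Eventually.of_forall fun s => ?_)).congr_deriv ?_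
          · simp [pow_two]
          · simp; ring
        have hden : HasDerivAt (fun t : ℝ => 2 * t) 2 t := by simpa using (hasDerivAt_id t).const_mul 2
        refine (hnum.div hden (by positivity)).congr_deriv ?_
        field_simp
        ring
      exact h1.sub (hGd t ht0)
    have hcont : ContinuousOn H (Set.Icc b a) := by
      refine ContinuousOn.sub ?_ fun t ht => ?_
      · refine ContinuousOn.div (by fun_prop) (by fun_prop) fun t ht => ?_
        have : 0 < t := hb.trans_le ht.1
        positivity
      · exact (hGd t (hb.trans_le ht.1)).continuousAt.continuousWithinAt
    have hanti : AntitoneOn H (Set.Icc b a) := by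
      refine antitoneOn_of_deriv_nonpos (convex_Icc b a) hcont ?_ ?_
      · rw [interior_Icc]
        exact fun t ht => (hHd t ht).differentiableAt.differentiableWithinAt
      · rw [interior_Icc]
        intro t ht
        rw [(hHd t ht).deriv, hformula t (hb.trans ht.1)]
        have ht0 : 0 < t := hb.trans ht.1
        have hta : 0 ≤ a - t := by linarith [ht.2]
        have hqt : 0 < 1 - exp (-t) := by
          have : exp (-t) < 1 := exp_lt_one_iff.2 (by linarith); linarith
        -- `(e^{-t} - e^{-a})/(1 - e^{-t}) ≤ e^{-t}(a-t)/(1-e^{-t}) ≤ (a-t)/t ≤ (a-t)(a+t)/(2t²)`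
        have hnum : exp (-t) - exp (-a) ≤ exp (-t) * (a - t) := by
          have h1 : exp (-t) - exp (-a) = exp (-t) * (1 - exp (-(a - t))) := by
            rw [mul_sub, mul_one, ← exp_add]; ring_nf
          rw [h1]
          exact mul_le_mul_of_nonneg_left (one_sub_exp_neg_le _) (exp_pos _).le
        have hstep : (exp (-t) - exp (-a)) / (1 - exp (-t)) ≤ (a - t) * (a + t) / (2 * t ^ 2) :=
          calc (exp (-t) - exp (-a)) / (1 - exp (-t)) ≤ exp (-t) * (a - t) / (1 - exp (-t)) :=
                div_le_div_of_nonneg_right hnum hqt.le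
            _ = exp (-t) / (1 - exp (-t)) * (a - t) := by ring
            _ ≤ 1 / t * (a - t) :=
                mul_le_mul_of_nonneg_right (exp_neg_div_one_sub_exp_neg_le ht0) hta
            _ ≤ (a - t) * (a + t) / (2 * t ^ 2) := by
                rw [div_mul_eq_mul_div, one_mul, div_le_div_iff₀ ht0 (by positivity)]
                have key : (a - t) * (a + t) * t - (a - t) * (2 * t ^ 2) = t * (a - t) ^ 2 := by ring
                nlinarith [mul_nonneg ht0.le (sq_nonneg (a - t))]
        have e3 : -((a - t) * (a + t)) / (2 * t ^ 2) - (exp (-a) - exp (-t)) / (1 - exp (-t)) =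
            (exp (-t) - exp (-a)) / (1 - exp (-t)) - (a - t) * (a + t) / (2 * t ^ 2) := by
          rw [neg_div, ← neg_sub (exp (-t)) (exp (-a)), neg_div]
          ring
        rw [e3]
        linarith
    have h := hanti (Set.left_mem_Icc.2 hba) (Set.right_mem_Icc.2 hba) hba
    have hHa : H a = 0 := by simp [hH, hGa]
    rw [hHa] at h
    have : 0 ≤ (a - b) ^ 2 / (2 * b) - G b := h
    linarith


/-! ### Relative entropy of finitely supported laws: the log-sum inequality and the
Dewan–Muirhead generalised Pinsker inequality -/

section Finite

variable {ι : Type*}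

/-- Termwise form of the log-sum inequality: for `P ≥ 0`, `Q, p, q > 0`,
`P log(P/Q) - P log(p/q) ≥ P - Q p/q` (from `log x ≥ 1 - 1/x`). [folklore] -/
theorem mul_log_div_sub_ge {P Q p q : ℝ} (hP : 0 ≤ P) (hQ : 0 < Q) (hp : 0 < p) (hq : 0 < q) :
    P - Q * p / q ≤ P * log (P / Q) - P * log (p / q) := by
  rcases hP.eq_or_lt with h0 | hPpos
  · rw [← h0]; simp; positivity
  · have hx : 0 < P * q / (Q * p) := by positivity
    have hlog : log (P / Q) - log (p / q) = log (P * q / (Q * p)) := by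
      rw [← log_div (by positivity) (by positivity)]
      congr 1
      field_simp
    have key : 1 - (P * q / (Q * p))⁻¹ ≤ log (P * q / (Q * p)) := by
      have h := log_le_sub_one_of_pos (inv_pos.2 hx)
      rw [log_inv] at h
      linarith
    have hinv : (P * q / (Q * p))⁻¹ = Q * p / (P * q) := by rw [inv_div]
    rw [hinv] at key
    calc P - Q * p / q = P * (1 - Q * p / (P * q)) := by field_simp
      _ ≤ P * log (P * q / (Q * p)) := mul_le_mul_of_nonneg_left key hP
      _ = P * log (P / Q) - P * log (p / q) := by rw [← mul_sub, hlog]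

/-- **Log-sum inequality** on a finite set: for `P ≥ 0` and `Q > 0` on `s`,
`(Σ_s P) log(Σ_s P / Σ_s Q) ≤ Σ_s P log(P/Q)`. [folklore] -/
theorem sum_mul_log_div_le (s : Finset ι) (P Q : ι → ℝ) (hP : ∀ i ∈ s, 0 ≤ P i)
    (hQ : ∀ i ∈ s, 0 < Q i) :
    (∑ i ∈ s, P i) * log ((∑ i ∈ s, P i) / (∑ i ∈ s, Q i)) ≤ ∑ i ∈ s, P i * log (P i / Q i) := by
  set p := ∑ i ∈ s, P i with hp
  set q := ∑ i ∈ s, Q i with hq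
  have hp0 : 0 ≤ p := sum_nonneg hP
  rcases hp0.eq_or_lt with hpz | hppos
  · -- `p = 0`: all `P i = 0`
    have hPi : ∀ i ∈ s, P i = 0 := (sum_eq_zero_iff_of_nonneg hP).1 hpz.symm
    rw [← hpz, zero_mul]
    exact le_of_eq (sum_eq_zero fun i hi => by rw [hPi i hi]; simp).symm
  · have hs : s.Nonempty := by
      by_contra h
      rw [not_nonempty_iff_eq_empty] at h
      rw [hp, h, sum_empty] at hppos
      exact lt_irrefl _ hppos
    have hqpos : 0 < q := sum_pos hQ hs
    have key : ∑ i ∈ s, (P i - Q i * p / q) ≤ ∑ i ∈ s, (P i * log (P i / Q i) - P i * log (p / q)) :=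
      sum_le_sum fun i hi => mul_log_div_sub_ge (hP i hi) (hQ i hi) hppos hqpos
    rw [sum_sub_distrib, sum_sub_distrib, ← sum_mul] at key
    have h0 : ∑ i ∈ s, Q i * p / q = p := by
      simp_rw [mul_div_assoc]
      rw [← sum_mul, ← hq]
      field_simp
    rw [h0, sub_self] at key
    linarith

/-- **The relative entropy dominates the binary relative entropy of any event** (data processing
for the indicator of `A`): for probability weights `P ≥ 0`, `Q > 0` on `s` and `A ⊆ s`,
`kl(P(A) ‖ Q(A)) ≤ Σ_s P log(P/Q)`. [cite: Hutchcroft2022Triangle, §4 (proof of Thm. 4.1: "applying the generalised Pinsker inequality … to the laws of X and Y and the event 𝒜")] -/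
theorem binaryKL_le_sum_mul_log_div [DecidableEq ι] (s A : Finset ι) (hA : A ⊆ s) (P Q : ι → ℝ)
    (hP : ∀ i ∈ s, 0 ≤ P i) (hQ : ∀ i ∈ s, 0 < Q i) (hP1 : ∑ i ∈ s, P i = 1)
    (hQ1 : ∑ i ∈ s, Q i = 1) :
    binaryKL (∑ i ∈ A, P i) (∑ i ∈ A, Q i) ≤ ∑ i ∈ s, P i * log (P i / Q i) := by
  have hsplitP : ∑ i ∈ s \ A, P i = 1 - ∑ i ∈ A, P i := by
    rw [← hP1, ← sum_sdiff hA]; ring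
  have hsplitQ : ∑ i ∈ s \ A, Q i = 1 - ∑ i ∈ A, Q i := by
    rw [← hQ1, ← sum_sdiff hA]; ring
  have h1 := sum_mul_log_div_le A P Q (fun i hi => hP i (hA hi)) (fun i hi => hQ i (hA hi))
  have h2 := sum_mul_log_div_le (s \ A) P Q (fun i hi => hP i (sdiff_subset hi))
    (fun i hi => hQ i (sdiff_subset hi))
  rw [hsplitP, hsplitQ] at h2
  rw [← sum_sdiff hA, binaryKL]
  linarith

/-- **Dewan–Muirhead's generalised Pinsker inequality**, for finitely supported laws with full
support: `|P(A) - Q(A)|² ≤ 2 D_KL(P ‖ Q) max{P(A), Q(A)}` with `D_KL(P ‖ Q) = Σ_s P log(P/Q)`.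
[cite: Hutchcroft2022Triangle, §4 (display (Pinsker): |μ(A) - ν(A)|² ≤ 2 D_KL(μ‖ν) max{μ(A), ν(A)})] -/
theorem sq_sub_le_two_mul_kl_mul_max [DecidableEq ι] (s A : Finset ι) (hA : A ⊆ s) (P Q : ι → ℝ)
    (hP : ∀ i ∈ s, 0 < P i) (hQ : ∀ i ∈ s, 0 < Q i) (hP1 : ∑ i ∈ s, P i = 1)
    (hQ1 : ∑ i ∈ s, Q i = 1) :
    (∑ i ∈ A, P i - ∑ i ∈ A, Q i) ^ 2 ≤
      2 * (∑ i ∈ s, P i * log (P i / Q i)) * max (∑ i ∈ A, P i) (∑ i ∈ A, Q i) := by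
  set a := ∑ i ∈ A, P i with ha
  set b := ∑ i ∈ A, Q i with hb
  have hP' : ∀ i ∈ s, 0 ≤ P i := fun i hi => (hP i hi).le
  have hKL0 : 0 ≤ ∑ i ∈ s, P i * log (P i / Q i) := by
    have h := sum_mul_log_div_le s P Q hP' hQ
    rw [hP1, hQ1] at h
    simpa using h
  have hKLA : binaryKL a b ≤ ∑ i ∈ s, P i * log (P i / Q i) :=
    binaryKL_le_sum_mul_log_div s A hA P Q hP' hQ hP1 hQ1
  have ha0 : 0 ≤ a := sum_nonneg fun i hi => hP' i (hA hi)
  have hb0 : 0 ≤ b := sum_nonneg fun i hi => (hQ i (hA hi)).le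
  -- `a = 0 ↔ A = ∅ ↔ b = 0` and `a = 1 ↔ A = s ↔ b = 1`, by full support
  have hA_empty_of : (∀ R : ι → ℝ, (∀ i ∈ s, 0 < R i) → ∑ i ∈ A, R i = 0 → A = ∅) := by
    intro R hR h0
    by_contra hne
    obtain ⟨i, hi⟩ := nonempty_iff_ne_empty.2 hne
    have := sum_pos (fun j hj => hR j (hA hj)) ⟨i, hi⟩
    linarith
  have hA_full_of : (∀ R : ι → ℝ, (∀ i ∈ s, 0 < R i) → ∑ i ∈ s, R i = 1 → ∑ i ∈ A, R i = 1 →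
      s \ A = ∅) := by
    intro R hR h1 hA1
    have h0 : ∑ i ∈ s \ A, R i = 0 := by rw [← sum_sdiff hA] at h1; linarith
    by_contra hne
    obtain ⟨i, hi⟩ := nonempty_iff_ne_empty.2 hne
    have := sum_pos (fun j hj => hR j (sdiff_subset hj)) ⟨i, hi⟩
    linarith
  have ha1 : a ≤ 1 := by
    rw [← hP1, ← sum_sdiff hA]
    linarith [sum_nonneg fun i (hi : i ∈ s \ A) => hP' i (sdiff_subset hi)]
  have hb1 : b ≤ 1 := by
    rw [← hQ1, ← sum_sdiff hA]
    linarith [sum_nonneg fun i (hi : i ∈ s \ A) => (hQ i (sdiff_subset hi)).le]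
  rcases ha0.eq_or_lt with haz | hapos
  · -- `a = 0`: then `A = ∅` and `b = 0`
    have hAe : A = ∅ := hA_empty_of P hP haz.symm
    have hbz : b = 0 := by rw [hb, hAe, sum_empty]
    rw [← haz, hbz]; simp
  rcases ha1.lt_or_eq with halt | haone
  · -- `0 < a < 1`: then also `0 < b < 1`
    have hbpos : 0 < b := by
      rcases hb0.eq_or_lt with hbz | hbpos
      · have hAe : A = ∅ := hA_empty_of Q hQ hbz.symm
        rw [ha, hAe, sum_empty] at hapos
        exact absurd hapos (lt_irrefl _)
      · exact hbpos
    have hblt : b < 1 := by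
      rcases hb1.lt_or_eq with hblt | hbone
      · exact hblt
      · have hsA : s \ A = ∅ := hA_full_of Q hQ hQ1 hbone
        have : a = 1 := by
          rw [ha, ← hP1, ← sum_sdiff hA, hsA, sum_empty, zero_add]
        linarith
    calc (a - b) ^ 2 ≤ 2 * binaryKL a b * max a b := sq_sub_le_two_mul_binaryKL_mul_max hapos halt hbpos hblt
      _ ≤ 2 * (∑ i ∈ s, P i * log (P i / Q i)) * max a b := by gcongr
  · -- `a = 1`: then `A ⊇ s` and `b = 1`
    have hsA : s \ A = ∅ := hA_full_of P hP hP1 haone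
    have hbone : b = 1 := by rw [hb, ← hQ1, ← sum_sdiff hA, hsA, sum_empty, zero_add]
    rw [haone, hbone]
    simp only [sub_self, ne_eq, OfNat.ofNat_ne_zero, not_false_eq_true, zero_pow, max_self, mul_one]
    positivity

end Finite

end Literature.Probability.Entropy

end


/-! ### Appended: symmetry under complement and nonnegativity -/

namespace Literature.Probability.Entropy

open Real

/-- `kl(1-a ‖ 1-b) = kl(a ‖ b)` (the first equality of Hutchcroft's Lemma 4.3:
`D_KL(Ber(1-e^{-a}) ‖ Ber(1-e^{-b})) = D_KL(Ber(e^{-a}) ‖ Ber(e^{-b}))`).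
[cite: Hutchcroft2022Triangle, Lemma 4.3 (first equality)] -/
theorem binaryKL_one_sub (a b : ℝ) : binaryKL (1 - a) (1 - b) = binaryKL a b := by
  simp only [binaryKL, sub_sub_cancel]
  ring

/-- **Gibbs' inequality for Bernoulli laws**: `0 ≤ kl(a ‖ b)` for `a ∈ [0, 1]`, `b ∈ (0, 1)`
(from `log x ≥ 1 - 1/x`). [folklore] -/
theorem binaryKL_nonneg {a b : ℝ} (ha0 : 0 ≤ a) (ha1 : a ≤ 1) (hb0 : 0 < b) (hb1 : b < 1) :
    0 ≤ binaryKL a b := by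
  have h1b : 0 < 1 - b := by linarith
  -- termwise `P log(P/Q) ≥ P - Q` for `P ≥ 0`, `Q > 0`
  have key : ∀ {P Q : ℝ}, 0 ≤ P → 0 < Q → P - Q ≤ P * log (P / Q) := by
    intro P Q hP hQ
    rcases hP.eq_or_lt with h0 | hPpos
    · rw [← h0]; simp; exact hQ.le
    · have hx : 0 < Q / P := by positivity
      have h := log_le_sub_one_of_pos hx
      rw [log_div hQ.ne' hPpos.ne'] at h
      have : log (P / Q) = log P - log Q := log_div hPpos.ne' hQ.ne'
      rw [this]
      have hmul := mul_le_mul_of_nonneg_left h hPpos.le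
      have e1 : P * (Q / P - 1) = Q - P := by field_simp
      nlinarith
  have hA := key ha0 hb0
  have hB := key (sub_nonneg.2 ha1) h1b
  unfold binaryKL
  linarith

end Literature.Probability.Entropy
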